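import Mathlib.LinearAlgebra.Dual.Lemmas
import Mathlib.LinearAlgebra.Contraction
import Mathlib.LinearAlgebra.TensorProduct.Tower
import Mathlib.RingTheory.TensorProduct.Basic
import Mathlib.Analysis.Complex.Basic
import Mathlib.LinearAlgebra.FiniteDimensional.Lemmas
import HarnessLib

/-!
# The eigenline of a number-field line under base change to `ℂ` is a line

Topic `Literature/LinearAlgebra/BaseChange` (linear algebra; Mathlib only).  Let `M ⊆ ℂ` be a field that is finite-dimensional
over `ℚ` (a number field with a fixed complex embedding `algebraMap M ℂ`), and `L` an `M`-vector space of `M`-dimension `1`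
with its underlying `ℚ`-structure.  The **eigenline** of `ℂ ⊗_ℚ L` is «the maximal subspace of the complex vector space
`ℂ ⊗_ℚ L` over which `M` acts via the inclusion `M ↪ ℂ`» — `{β | ∀ m, (m • ·) ⊗ ℂ β = m · β}`.  This file proves:

* `eigenlineOf M L` (definition) and `mem_eigenlineOf`;
* `finrank_eigenlineOf_of_line` — **the eigenline is a line**: `finrank ℂ (eigenlineOf M L) = 1` when `finrank M L = 1`;
* `exists_mem_eigenlineOf_ne_zero` — hence a non-zero eigenvector exists («we choose a basis `α` of this subspace»);
* `finrank_eq_one_of_finrank_rat_eq` — a module over `M` of `ℚ`-dimension `[M:ℚ]` is an `M`-line;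
through the case `L = M`: `eigenlineTau M`, `finrank_eigenlineTau`, `exists_eigenvector_ne_zero` — via PRIVATE plumbing: the
explicit generator `alpha0 = κ⁻¹(τ)` and its uniqueness, built from the duality `κ : ℂ ⊗_ℚ M ≃ Hom_ℚ(M, ℂ)`, `z ⊗ x ↦ (y ↦ ξ₀(xy) z)`
through ANY non-zero `ξ₀ ∈ M^∨` (`pairDual`, `kappaInv`, `kappaC`; no trace form, no Galois theory).

In print this is the first sentence of the proof of [Liu 2021, Thm. 4.18] (Camb. J. Math. 9 = arXiv:2102.11518, `FJcycle.tex`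
l. 2250): «It is clear that the maximal subspace of the complex vector space `H¹_{B,τ'}(A_μ, ℂ)` over which `M_μ` acts via the
inclusion `M_μ ↪ ℂ` has dimension `1`» (with `L = H¹_{B,τ'}(A_μ, ℚ)`, an `M_μ`-line because `dim A_μ = [M_μ:ℚ]/2`, l. 650), and
Deligne, *Hodge cycles on abelian varieties* (LNM 900), Example 3.7 / §4 p. 30 (`E ⊗_ℚ ℂ ≃ ℂ^{Hom(E,ℂ)}`, `dim_ℂ V_{ℂ,σ} = dim_E V`;
the tree's `HodgeStructure.EndAction.finrank_iInf_eigenspace_mul_finrank` is the Hodge-structure-bound form of the same count).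

PROVENANCE: the Lean text of this file is the (E5)/(E2-alg) part of the kernel-checked sketch `RouteJ-Sketch.lean` v1.5 /
`Map43Rational-kit.lean` (md5 87c47dfbcb81) written by the pub-hodgecm2 planner seat s2crux-idea-1 (gen 7) for transplant, moved
here VERBATIM up to namespace and headers by the writer of record (item6-p1); theorems and definitions only, no named fact.

## References
* [Liu2021] Y. Liu, *Fourier–Jacobi cycles and arithmetic relative trace formula*, Camb. J. Math. 9 (2021), proof of Thm. 4.18
  (FJcycle.tex l. 2250) and l. 650.
* [Deligne1982HodgeCycles] P. Deligne, *Hodge cycles on abelian varieties*, LNM 900 (1982), Example 3.7, §4 p. 30.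
-/

noncomputable section

open scoped TensorProduct

namespace Literature.LinearAlgebra.BaseChange

/-! ## The duality `M ≅ M^∨` through a non-zero `ξ₀ ∈ M^∨` -/

section Duality

variable {M : Type} [Field M] [CharZero M]

/-- `m ↦ (y ↦ ξ₀ (m * y))`. [folklore] -/
private def pairDual (ξ₀ : Module.Dual ℚ M) : M →ₗ[ℚ] Module.Dual ℚ M := (LinearMap.mul ℚ M).compr₂ ξ₀

/-- Unfolding of `pairDual`. [folklore] -/
@[simp] private theorem pairDual_apply (ξ₀ : Module.Dual ℚ M) (m y : M) : pairDual ξ₀ m y = ξ₀ (m * y) := rfl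

/-- `pairDual ξ₀` is injective for `ξ₀ ≠ 0` (`M` is a field). [folklore] -/
private theorem pairDual_injective {ξ₀ : Module.Dual ℚ M} (hξ : ξ₀ ≠ 0) : Function.Injective (pairDual ξ₀) := by
  rw [injective_iff_map_eq_zero]
  intro m hm
  by_contra hm0
  apply hξ
  ext y
  have := LinearMap.congr_fun hm (m⁻¹ * y)
  simpa [pairDual_apply, mul_inv_cancel_left₀ hm0] using this

variable [Module.Finite ℚ M]

/-- … hence bijective when `M` is finite-dimensional over `ℚ` (`dim M^∨ = dim M`). [folklore] -/
private theorem pairDual_bijective {ξ₀ : Module.Dual ℚ M} (hξ : ξ₀ ≠ 0) : Function.Bijective (pairDual ξ₀) :=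
  ⟨pairDual_injective hξ,
    (LinearMap.injective_iff_surjective_of_finrank_eq_finrank (Subspace.dual_finrank_eq).symm).1
      (pairDual_injective hξ)⟩

variable (U : Type) [AddCommGroup U] [Module ℚ U]

/-- `κ⁻¹ : M ⊗[ℚ] U ≃ Hom_ℚ(M, U)`, `m ⊗ u ↦ (y ↦ ξ₀ (m y) • u)`. [folklore] -/
private noncomputable def kappaInv {ξ₀ : Module.Dual ℚ M} (hξ : ξ₀ ≠ 0) : M ⊗[ℚ] U ≃ₗ[ℚ] (M →ₗ[ℚ] U) :=
  (LinearEquiv.ofBijective (pairDual ξ₀) (pairDual_bijective hξ)).rTensor U ≪≫ₗ dualTensorHomEquiv ℚ M U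

/-- `κ⁻¹` on pure tensors. [folklore] -/
private theorem kappaInv_tmul {ξ₀ : Module.Dual ℚ M} (hξ : ξ₀ ≠ 0) (m : M) (u : U) (y : M) :
    kappaInv U hξ (m ⊗ₜ[ℚ] u) y = ξ₀ (m * y) • u := by
  simp [kappaInv, dualTensorHomEquiv]


end Duality

/-! ## (E5) THE EIGENLINE IS A LINE — clause (i) of the proof of [Liu21] Thm 4.18 (FJcycle.tex l. 2250 «has dimension 1») as a THEOREM
of linear algebra: in `ℂ ⊗_ℚ M` the joint eigenspace of the `M`-action for the character `M ⊆ ℂ` is one-dimensional and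
spanned by `κ⁻¹(τ)`, where `κ : ℂ ⊗_ℚ M ≅ Hom_ℚ(M, ℂ)`, `z ⊗ x ↦ (y ↦ ξ₀(xy) z)` is the trace-form-type duality through
any non-zero `ξ₀ ∈ M^∨` (s2crux-idea-1's bridge (E3b) of `Liu2021/Map43Injective`-type arguments); transported to any `M`-line `L` below. -/

section EigenlineIsALine

variable {M : Type} [Field M] [CharZero M] [Module.Finite ℚ M]

/-- `κ : ℂ ⊗_ℚ M ≃ Hom_ℚ(M, ℂ)`, `z ⊗ x ↦ (y ↦ ξ₀ (x y) • z)`. [folklore] -/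
private noncomputable def kappaC {ξ₀ : Module.Dual ℚ M} (hξ : ξ₀ ≠ 0) : ℂ ⊗[ℚ] M ≃ₗ[ℚ] (M →ₗ[ℚ] ℂ) :=
  TensorProduct.comm ℚ ℂ M ≪≫ₗ kappaInv ℂ hξ

/-- `κ` on pure tensors. [folklore] -/
private theorem kappaC_tmul {ξ₀ : Module.Dual ℚ M} (hξ : ξ₀ ≠ 0) (z : ℂ) (x y : M) :
    kappaC hξ (z ⊗ₜ[ℚ] x) y = ξ₀ (x * y) • z := by
  simp [kappaC, kappaInv_tmul]

/-- `κ` intertwines multiplication by `1 ⊗ m` with precomposition by `m ·`. [folklore] -/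
private theorem kappaC_mul {ξ₀ : Module.Dual ℚ M} (hξ : ξ₀ ≠ 0) (m : M) (β : ℂ ⊗[ℚ] M) :
    kappaC hξ (((1 : ℂ) ⊗ₜ[ℚ] m) * β) = kappaC hξ β ∘ₗ LinearMap.mulLeft ℚ m := by
  induction β using TensorProduct.induction_on with
  | zero => simp
  | tmul z x =>
      ext y
      rw [Algebra.TensorProduct.tmul_mul_tmul, one_mul, kappaC_tmul, LinearMap.comp_apply, LinearMap.mulLeft_apply,
        kappaC_tmul, show m * x * y = x * (m * y) by ring]
  | add b₁ b₂ h₁ h₂ => simp [mul_add, h₁, h₂, LinearMap.add_comp]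

/-- `κ` is `ℂ`-linear. [folklore] -/
private theorem kappaC_smul {ξ₀ : Module.Dual ℚ M} (hξ : ξ₀ ≠ 0) (c : ℂ) (β : ℂ ⊗[ℚ] M) :
    kappaC hξ (c • β) = c • kappaC hξ β := by
  induction β using TensorProduct.induction_on with
  | zero => simp
  | tmul z x =>
      ext y
      rw [TensorProduct.smul_tmul', kappaC_tmul, LinearMap.smul_apply, kappaC_tmul, smul_eq_mul, smul_eq_mul,
        mul_smul_comm]
  | add b₁ b₂ h₁ h₂ => simp [smul_add, h₁, h₂]

omit [Module.Finite ℚ M] in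
/-- multiplication by `1 ⊗ m` on `ℂ ⊗_ℚ M` is the base change of `mulLeft m`. [folklore] -/
private theorem one_tmul_mul_eq_baseChange (m : M) (β : ℂ ⊗[ℚ] M) :
    ((1 : ℂ) ⊗ₜ[ℚ] m) * β = (LinearMap.mulLeft ℚ m).baseChange ℂ β := by
  induction β using TensorProduct.induction_on with
  | zero => simp
  | tmul a y => simp [Algebra.TensorProduct.tmul_mul_tmul]
  | add b₁ b₂ h₁ h₂ => simp [mul_add, h₁, h₂]

variable [Algebra M ℂ] [IsScalarTower ℚ M ℂ]

variable (M) in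
/-- the character `τ = algebraMap M ℂ` as a `ℚ`-linear map. [folklore] -/
private noncomputable def tauQ : M →ₗ[ℚ] ℂ := (Algebra.linearMap M ℂ).restrictScalars ℚ

omit [Module.Finite ℚ M] in
/-- Unfolding of `tauQ`. [folklore] -/
@[simp] private theorem tauQ_apply (m : M) : tauQ M m = algebraMap M ℂ m := rfl

/-- the distinguished eigenvector `α₀ := κ⁻¹(τ)`. [folklore] -/
private noncomputable def alpha0 {ξ₀ : Module.Dual ℚ M} (hξ : ξ₀ ≠ 0) : ℂ ⊗[ℚ] M := (kappaC hξ).symm (tauQ M)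

/-- `α₀ ≠ 0`. [folklore] -/
private theorem alpha0_ne_zero {ξ₀ : Module.Dual ℚ M} (hξ : ξ₀ ≠ 0) : alpha0 hξ ≠ 0 := by
  intro h
  have h1 := congrArg (kappaC hξ) h
  rw [alpha0, LinearEquiv.apply_symm_apply, map_zero] at h1
  have h2 := LinearMap.congr_fun h1 1
  simp at h2

/-- `α₀` is a `τ`-eigenvector: `(1 ⊗ m) · α₀ = τ(m) · α₀`. [folklore] -/
private theorem alpha0_eigen {ξ₀ : Module.Dual ℚ M} (hξ : ξ₀ ≠ 0) (m : M) :
    ((1 : ℂ) ⊗ₜ[ℚ] m) * alpha0 hξ = algebraMap M ℂ m • alpha0 hξ := by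
  apply (kappaC hξ).injective
  rw [kappaC_mul, kappaC_smul, alpha0, LinearEquiv.apply_symm_apply]
  ext y
  simp only [LinearMap.comp_apply, LinearMap.mulLeft_apply, LinearMap.smul_apply, tauQ_apply, map_mul, smul_eq_mul]

/-- **uniqueness**: every `τ`-eigenvector is a multiple of `α₀`. [folklore] -/
private theorem eigenvector_eq_smul_alpha0 {ξ₀ : Module.Dual ℚ M} (hξ : ξ₀ ≠ 0) (β : ℂ ⊗[ℚ] M)
    (hβ : ∀ m : M, ((1 : ℂ) ⊗ₜ[ℚ] m) * β = algebraMap M ℂ m • β) :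
    β = (kappaC hξ β 1) • alpha0 hξ := by
  apply (kappaC hξ).injective
  rw [kappaC_smul, alpha0, LinearEquiv.apply_symm_apply]
  ext y
  have h1 := congrArg (kappaC hξ) (hβ y)
  rw [kappaC_mul, kappaC_smul] at h1
  have h2 := LinearMap.congr_fun h1 1
  simp only [LinearMap.comp_apply, LinearMap.mulLeft_apply, mul_one, LinearMap.smul_apply] at h2
  rw [h2, LinearMap.smul_apply, tauQ_apply, smul_eq_mul, smul_eq_mul, mul_comm]

/-- **(E5) existence, PROVED**: a non-zero `τ`-eigenvector exists in `ℂ ⊗_ℚ M`. [cite: Deligne1982HodgeCycles, I Example 3.7 and §4 p. 30] [cite: Liu2021, proof of Thm. 4.18 (FJcycle.tex l. 2250)] -/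
theorem exists_eigenvector_ne_zero :
    ∃ α : ℂ ⊗[ℚ] M, α ≠ 0 ∧ ∀ m : M, ((1 : ℂ) ⊗ₜ[ℚ] m) * α = algebraMap M ℂ m • α := by
  obtain ⟨ξ₀, hξ⟩ := exists_ne (0 : Module.Dual ℚ M)
  exact ⟨alpha0 hξ, alpha0_ne_zero hξ, alpha0_eigen hξ⟩

variable (M) in
/-- the `τ`-eigenline of `ℂ ⊗_ℚ M` («the maximal subspace over which `M` acts via the inclusion `M ↪ ℂ`»). [cite: Liu2021, proof of Thm. 4.18 (FJcycle.tex l. 2250)] -/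
noncomputable def eigenlineTau : Submodule ℂ (ℂ ⊗[ℚ] M) where
  carrier := {β | ∀ m : M, ((1 : ℂ) ⊗ₜ[ℚ] m) * β = algebraMap M ℂ m • β}
  zero_mem' := fun m => by simp
  add_mem' := fun {a b} ha hb m => by rw [mul_add, ha m, hb m, smul_add]
  smul_mem' := fun c {β} hβ m => by
    show ((1 : ℂ) ⊗ₜ[ℚ] m) * (c • β) = algebraMap M ℂ m • (c • β)
    rw [mul_smul_comm, hβ m, smul_comm]

omit [Module.Finite ℚ M] [IsScalarTower ℚ M ℂ] in
/-- Membership in `eigenlineTau`. [cite: Liu2021, proof of Thm. 4.18 (FJcycle.tex l. 2250)] -/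
theorem mem_eigenlineTau {β : ℂ ⊗[ℚ] M} :
    β ∈ eigenlineTau M ↔ ∀ m : M, ((1 : ℂ) ⊗ₜ[ℚ] m) * β = algebraMap M ℂ m • β := Iff.rfl

/-- **(E5) PROVED: the eigenline is a line** (`finrank = 1`). [cite: Deligne1982HodgeCycles, I Example 3.7 and §4 p. 30] [cite: Liu2021, proof of Thm. 4.18 (FJcycle.tex l. 2250)] -/
theorem finrank_eigenlineTau : Module.finrank ℂ (eigenlineTau M) = 1 := by
  obtain ⟨ξ₀, hξ⟩ := exists_ne (0 : Module.Dual ℚ M)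
  have hmem : alpha0 hξ ∈ eigenlineTau M := alpha0_eigen hξ
  have hv : (⟨alpha0 hξ, hmem⟩ : eigenlineTau M) ≠ 0 := by
    intro h
    exact alpha0_ne_zero hξ (congrArg Subtype.val h)
  refine (finrank_eq_one_iff_of_nonzero' _ hv).2 fun w => ?_
  refine ⟨kappaC hξ w.1 1, Subtype.ext ?_⟩
  show (kappaC hξ w.1 1) • alpha0 hξ = w.1
  exact (eigenvector_eq_smul_alpha0 hξ w.1 w.2).symm

variable (M) in
/-- the `τ`-eigenline of `ℂ ⊗_ℚ L` for an `M`-module `L` with its `ℚ`-structure (the consumer's `H¹(A_μ; ℚ)` with `i_μ`):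
«the maximal subspace of `H¹_{B,τ'}(A_μ, ℂ)` over which `M_μ` acts via the inclusion `M_μ ↪ ℂ`» (l. 2248–2249). [cite: Liu2021, proof of Thm. 4.18 (FJcycle.tex l. 2250)] -/
def eigenlineOf (L : Type) [AddCommGroup L] [Module M L] [Module ℚ L] : Submodule ℂ (ℂ ⊗[ℚ] L) where
  carrier := {β | ∀ m : M, (DistribSMul.toLinearMap ℚ L m).baseChange ℂ β = algebraMap M ℂ m • β}
  zero_mem' := fun m => by simp
  add_mem' := fun {a b} ha hb m => by rw [map_add, ha m, hb m, smul_add]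
  smul_mem' := fun c {β} hβ m => by
    show (DistribSMul.toLinearMap ℚ L m).baseChange ℂ (c • β) = algebraMap M ℂ m • (c • β)
    rw [map_smul, hβ m, smul_comm]

omit [CharZero M] [Module.Finite ℚ M] [IsScalarTower ℚ M ℂ] in
/-- Membership in `eigenlineOf`. [cite: Liu2021, proof of Thm. 4.18 (FJcycle.tex l. 2250)] -/
theorem mem_eigenlineOf {L : Type} [AddCommGroup L] [Module M L] [Module ℚ L] {β : ℂ ⊗[ℚ] L} :
    β ∈ eigenlineOf M L ↔ ∀ m : M, (DistribSMul.toLinearMap ℚ L m).baseChange ℂ β = algebraMap M ℂ m • β :=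
  Iff.rfl

/-- **(E5-line) PROVED: for an `M`-LINE `L` the `τ`-eigenline of `ℂ ⊗_ℚ L` is a line** — clause (i) «has dimension 1»
(l. 2249) from `dim_ℚ H¹(A_μ; ℚ) = [M_μ : ℚ]` alone (with (E2-alg)). [cite: Deligne1982HodgeCycles, I Example 3.7 and §4 p. 30] [cite: Liu2021, proof of Thm. 4.18 (FJcycle.tex l. 2250)] -/
theorem finrank_eigenlineOf_of_line (L : Type) [AddCommGroup L] [Module M L] [Module ℚ L] [IsScalarTower ℚ M L]
    (hL : Module.finrank M L = 1) : Module.finrank ℂ (eigenlineOf M L) = 1 := by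
  -- `e : M ≃ L`, `m ↦ m • ℓ₀`, and its base change `E : ℂ ⊗ M ≃ ℂ ⊗ L`
  have : Nontrivial L := Module.nontrivial_of_finrank_pos (R := M) (hL ▸ Nat.one_pos)
  obtain ⟨ℓ₀, hℓ₀⟩ : ∃ ℓ : L, ℓ ≠ 0 := exists_ne 0
  have hsurj : ∀ w : L, ∃ c : M, c • ℓ₀ = w := (finrank_eq_one_iff_of_nonzero' ℓ₀ hℓ₀).1 hL
  let e0 : M →ₗ[M] L := LinearMap.toSpanSingleton M L ℓ₀
  have he0 : ∀ m, e0 m = m • ℓ₀ := fun m => rfl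
  have he0inj : Function.Injective e0 := by
    rw [injective_iff_map_eq_zero]
    intro m hm
    rw [he0] at hm
    exact (smul_eq_zero.mp hm).resolve_right hℓ₀
  let e : M ≃ₗ[M] L := LinearEquiv.ofBijective e0 ⟨he0inj, fun w => hsurj w⟩
  let eQ : M →ₗ[ℚ] L := e.toLinearMap.restrictScalars ℚ
  let E : ℂ ⊗[ℚ] M ≃ₗ[ℂ] ℂ ⊗[ℚ] L := (e.restrictScalars ℚ).baseChange ℚ ℂ M L
  have hEap : ∀ γ, E γ = eQ.baseChange ℂ γ := fun γ => rfl
  have hcommL : ∀ m : M, eQ ∘ₗ LinearMap.mulLeft ℚ m = DistribSMul.toLinearMap ℚ L m ∘ₗ eQ := fun m => by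
    ext x
    show e (m * x) = m • e x
    rw [← smul_eq_mul, map_smul]
  have hE : ∀ (m : M) (γ : ℂ ⊗[ℚ] M),
      E (((1 : ℂ) ⊗ₜ[ℚ] m) * γ) = (DistribSMul.toLinearMap ℚ L m).baseChange ℂ (E γ) := fun m γ => by
    rw [one_tmul_mul_eq_baseChange, hEap, hEap, ← LinearMap.comp_apply, ← LinearMap.baseChange_comp, hcommL,
      LinearMap.baseChange_comp, LinearMap.comp_apply]
  have hset : eigenlineOf M L = (eigenlineTau M).map (E : ℂ ⊗[ℚ] M →ₗ[ℂ] ℂ ⊗[ℚ] L) := by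
    rw [Submodule.map_equiv_eq_comap_symm]
    ext β
    simp only [Submodule.mem_comap, mem_eigenlineTau, mem_eigenlineOf, LinearEquiv.coe_coe]
    constructor
    · intro hβ m
      apply E.injective
      rw [hE, LinearEquiv.apply_symm_apply, map_smul, LinearEquiv.apply_symm_apply]
      exact hβ m
    · intro hγ m
      have h1 := congrArg E (hγ m)
      rw [hE, LinearEquiv.apply_symm_apply, map_smul, LinearEquiv.apply_symm_apply] at h1
      exact h1
  rw [hset, LinearEquiv.finrank_map_eq]
  exact finrank_eigenlineTau

/-- **(E5-line) existence, PROVED**: a non-zero eigenvector `α` («we choose a basis `α` of this subspace», l. 2249). [cite: Liu2021, proof of Thm. 4.18 (FJcycle.tex l. 2250)] -/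
theorem exists_mem_eigenlineOf_ne_zero (L : Type) [AddCommGroup L] [Module M L] [Module ℚ L] [IsScalarTower ℚ M L]
    (hL : Module.finrank M L = 1) : ∃ α ∈ eigenlineOf M L, α ≠ 0 := by
  have h : 0 < Module.finrank ℂ (eigenlineOf M L) := by rw [finrank_eigenlineOf_of_line L hL]; exact Nat.one_pos
  have : Nontrivial (eigenlineOf M L) := Module.nontrivial_of_finrank_pos h
  obtain ⟨⟨v, hv⟩, hne⟩ := exists_ne (0 : eigenlineOf M L)
  exact ⟨v, hv, fun h0 => hne (Subtype.ext h0)⟩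

end EigenlineIsALine

/-! ## (E2-alg) a module over `M` of `ℚ`-dimension `[M:ℚ]` is an `M`-line -/

section LineVersion

variable (M : Type) [Field M] [CharZero M] [Module.Finite ℚ M]

/-- **(E2-alg) PROVED.** A module over the field `M` whose `ℚ`-dimension is `[M:ℚ]` is a LINE over `M`
(with the tree's `AbelianVariety.finrank_complexBetti_one` and the printed `dim A_μ = [M_μ:ℚ]/2`, l. 650, this is (E2)). [cite: Liu2021, l. 650 with Def. 4.5 (2)] [cite: Deligne1982HodgeCycles, I §5 Prop. 5.1] -/
theorem finrank_eq_one_of_finrank_rat_eq (L : Type) [AddCommGroup L] [Module M L] [Module ℚ L]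
    [IsScalarTower ℚ M L] (h : Module.finrank ℚ L = Module.finrank ℚ M) : Module.finrank M L = 1 := by
  have hpos : 0 < Module.finrank ℚ M := Module.finrank_pos
  have ht := Module.finrank_mul_finrank ℚ M L
  rw [h] at ht
  exact Nat.eq_of_mul_eq_mul_left hpos (by rw [mul_one]; exact ht)

end LineVersion

end Literature.LinearAlgebra.BaseChange

end
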